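import Summits.Ventures.PercRepro.MSTheoremS
import Summits.Ventures.PercRepro.MSTightDefect
import Summits.Ventures.PercRepro.ExcessOneCompletionIdent

/-!
# The product coordinates of a tight family, read at a near-member

Second module of Theorem W (proofs/MINE1-theoremS.md, Addendum 12). For a tight family `G` with
addable part `M = Rstar G` (Theorem S, `MSTheoremS.lean`) the difference family is the flip
`Φ = flip M G = {t ∆ M : t ∈ G}`, and

* a twin-closed set lies in `Φ` iff its parts inside and outside `M` do (`mem_flip_iff_parts`);
  conversely a twin-closed `z` with `z \ M ∈ Φ` and `M \ z ∈ Φ` is a member (`mem_of_parts`);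
  in particular `x ∪ M ∈ G` for `x ∈ Φ` disjoint from `M` (`union_Rstar_mem`) and `M \ y ∈ G`
  for `y ∈ Φ` inside `M` (`Rstar_sdiff_mem`);
* the two agreement cells `t ∩ u`, `tᶜ ∩ uᶜ` of a twin-closed `u` at a member `t` lie in `Φ` iff
  the part of `t ∩ u` inside `M` and the part of `tᶜ ∩ uᶜ` outside `M` do (`cellsA_parts_iff`),
  and likewise for the disagreement cells `t \ u`, `u \ t` (`cellsC_parts_iff`); at the members
  `x ∪ M` and `M \ y` these criteria take the explicit forms `cellsA_union_iff`,
  `cellsC_union_iff`, `cellsA_sdiff_iff`, `cellsC_sdiff_iff`;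
* `u ∈ G` iff `u \ M ∈ Φ` and `M \ u ∈ Φ`; `uᶜ ∈ G` iff `uᶜ \ M ∈ Φ` and `u ∩ M ∈ Φ`
  (`mem_of_flags`, `compl_mem_of_flags`).
-/

namespace PercRepro.MSTight

open Finset
open scoped FinsetFamily symmDiff

variable {α : Type*} [DecidableEq α] [Fintype α]

variable {G : Finset (Finset α)} {M : Finset α}

/-- In a tight family, a twin-closed set lies in the flip iff its parts inside and outside the
addable part `M = Rstar G` do. -/
theorem mem_flip_iff_parts (hT : Tight G) (hM : M = Rstar G) {z : Finset α}
    (hz : TwinClosed G z) :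
    z ∈ flip M G ↔ z ∩ M ∈ flip M G ∧ z \ M ∈ flip M G := by
  subst hM
  have hG := dichotomy_of_tight hT
  constructor
  · intro h
    exact ⟨mem_flip_of_subset_of_twinClosed hG h inter_subset_left
        (hz.inter (twinClosed_Rstar G)),
      mem_flip_of_subset_of_twinClosed hG h sdiff_subset (hz.sdiff (twinClosed_Rstar G))⟩
  · rintro ⟨h1, h2⟩
    have := union_mem_flip_of_dichotomy hG hT h1 h2
    have heq : ((z ∩ Rstar G) ∩ Rstar G) ∪ ((z \ Rstar G) \ Rstar G) = z := by
      ext a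
      simp only [mem_union, mem_inter, mem_sdiff]
      tauto
    rwa [heq] at this

/-- The flip contains every twin-closed subset of one of its members. -/
theorem mem_flip_of_subset (hT : Tight G) (hM : M = Rstar G) {W W' : Finset α}
    (hW : W ∈ flip M G) (hW' : W' ⊆ W) (htc : TwinClosed G W') : W' ∈ flip M G := by
  subst hM
  exact mem_flip_of_subset_of_twinClosed (dichotomy_of_tight hT) hW hW' htc

/-- The part of a member outside the addable part is a flipped member. -/
theorem sdiff_Rstar_mem_flip (hT : Tight G) (hM : M = Rstar G) {t : Finset α} (ht : t ∈ G) :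
    t \ M ∈ flip M G := by
  refine mem_flip_of_subset hT hM (symmDiff_mem_flip (M := M) ht) ?_
    ((twinClosed_of_mem ht).sdiff (hM ▸ twinClosed_Rstar G))
  intro a ha
  rw [mem_sdiff] at ha
  exact mem_symmDiff.2 (Or.inl ha)

/-- The part of the addable part missing from a member is a flipped member. -/
theorem Rstar_sdiff_mem_flip (hT : Tight G) (hM : M = Rstar G) {t : Finset α} (ht : t ∈ G) :
    M \ t ∈ flip M G := by
  refine mem_flip_of_subset hT hM (symmDiff_mem_flip (M := M) ht) ?_
    ((hM ▸ twinClosed_Rstar G).sdiff (twinClosed_of_mem ht))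
  intro a ha
  rw [mem_sdiff] at ha
  exact mem_symmDiff.2 (Or.inr ha)

/-- A twin-closed set whose two parts are flipped members is a member. -/
theorem mem_of_parts (hT : Tight G) (hM : M = Rstar G) {z : Finset α} (hz : TwinClosed G z)
    (h1 : z \ M ∈ flip M G) (h2 : M \ z ∈ flip M G) : z ∈ G := by
  have hMtc : TwinClosed G M := hM ▸ twinClosed_Rstar G
  have hzM : z ∆ M ∈ flip M G := by
    rw [mem_flip_iff_parts hT hM (hz.symmDiff hMtc)]
    have e1 : (z ∆ M) ∩ M = M \ z := by
      ext a
      simp only [mem_inter, mem_symmDiff, mem_sdiff]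
      tauto
    have e2 : (z ∆ M) \ M = z \ M := by
      ext a
      simp only [mem_symmDiff, mem_sdiff]
      tauto
    rw [e1, e2]
    exact ⟨h2, h1⟩
  subst hM
  exact mem_of_symmDiff_mem_flip hzM

/-- A flipped member disjoint from the addable part, united with the addable part, is a member. -/
theorem union_Rstar_mem (hM : M = Rstar G) {x : Finset α} (hx : x ∈ flip M G)
    (hxM : Disjoint x M) : x ∪ M ∈ G := by
  have hd := Finset.disjoint_left.1 hxM
  have heq : (x ∪ M) ∆ M = x := by
    ext a
    simp only [mem_symmDiff, mem_union]
    constructor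
    · rintro (⟨h1 | h1, h2⟩ | ⟨h1, h2⟩)
      · exact h1
      · exact absurd h1 h2
      · exact absurd (Or.inr h1) h2
    · intro h
      exact Or.inl ⟨Or.inl h, hd h⟩
  subst hM
  apply mem_of_symmDiff_mem_flip (G := G)
  rwa [heq]

/-- The addable part minus a flipped member inside it is a member. -/
theorem Rstar_sdiff_mem (hM : M = Rstar G) {y : Finset α} (hy : y ∈ flip M G) (hyM : y ⊆ M) :
    M \ y ∈ G := by
  have heq : (M \ y) ∆ M = y := by
    ext a
    simp only [mem_symmDiff, mem_sdiff]
    constructor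
    · rintro (⟨⟨h1, h2⟩, h3⟩ | ⟨h1, h2⟩)
      · exact absurd h1 h3
      · by_contra h
        exact h2 ⟨h1, h⟩
    · intro h
      exact Or.inr ⟨hyM h, fun h' => h'.2 h⟩
  subst hM
  apply mem_of_symmDiff_mem_flip (G := G)
  rwa [heq]

/-- The agreement cells of a twin-closed `u` at a member, read off the product: the part of
`t ∩ u` inside `M` and the part of `tᶜ ∩ uᶜ` outside `M` decide A-signability. -/
theorem cellsA_parts_iff (hT : Tight G) (hM : M = Rstar G) {u : Finset α}
    (hutc : TwinClosed G u) {t : Finset α} (ht : t ∈ G) :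
    Cells (G \\ G) t u ↔
      (t ∩ u) ∩ M ∈ flip M G ∧
        ((Finset.univ \ t) ∩ (Finset.univ \ u)) \ M ∈ flip M G := by
  have hMtc : TwinClosed G M := hM ▸ twinClosed_Rstar G
  have htu : TwinClosed G (t ∩ u) := (twinClosed_of_mem ht).inter hutc
  have htc : TwinClosed G ((Finset.univ \ t) ∩ (Finset.univ \ u)) :=
    ((twinClosed_univ G).sdiff (twinClosed_of_mem ht)).inter ((twinClosed_univ G).sdiff hutc)
  have hB : (t ∩ u) \ M ∈ flip M G := by
    refine mem_flip_of_subset hT hM (sdiff_Rstar_mem_flip hT hM ht) ?_ (htu.sdiff hMtc)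
    intro a
    simp only [mem_sdiff, mem_inter]
    tauto
  have hC : ((Finset.univ \ t) ∩ (Finset.univ \ u)) ∩ M ∈ flip M G := by
    refine mem_flip_of_subset hT hM (Rstar_sdiff_mem_flip hT hM ht) ?_ (htc.inter hMtc)
    intro a
    simp only [mem_sdiff, mem_inter, mem_univ, true_and]
    tauto
  have hD : G \\ G = flip M G := hM ▸ diffs_eq_flip_of_tight hT
  dsimp only [Cells]
  rw [hD, mem_flip_iff_parts hT hM htu, mem_flip_iff_parts hT hM htc]
  exact ⟨fun h => ⟨h.1.1, h.2.2⟩, fun h => ⟨⟨h.1, hB⟩, hC, h.2⟩⟩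

/-- The disagreement cells of a twin-closed `u` at a member, read off the product: the part of
`t \ u` inside `M` and the part of `u \ t` outside `M` decide C*-signability. -/
theorem cellsC_parts_iff (hT : Tight G) (hM : M = Rstar G) {u : Finset α}
    (hutc : TwinClosed G u) {t : Finset α} (ht : t ∈ G) :
    Cells (G \\ G) t (Finset.univ \ u) ↔
      (t \ u) ∩ M ∈ flip M G ∧ (u \ t) \ M ∈ flip M G := by
  rw [cellsA_parts_iff hT hM ((twinClosed_univ G).sdiff hutc) ht]
  have e1 : t ∩ (Finset.univ \ u) = t \ u := by
    ext a
    simp only [mem_inter, mem_sdiff, mem_univ, true_and]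
  have e2 : (Finset.univ \ t) ∩ (Finset.univ \ (Finset.univ \ u)) = u \ t := by
    ext a
    simp only [mem_inter, mem_sdiff, mem_univ, true_and, not_not]
    tauto
  rw [e1, e2]

/-- A-signability of the member `x ∪ M` (`x` disjoint from `M`): `u ∩ M ∈ Φ` and
`(uᶜ \ M) \ x ∈ Φ`. -/
theorem cellsA_union_iff (hT : Tight G) (hM : M = Rstar G) {u : Finset α}
    (hutc : TwinClosed G u) {x : Finset α} (hx : x ∪ M ∈ G) :
    Cells (G \\ G) (x ∪ M) u ↔
      u ∩ M ∈ flip M G ∧ ((Finset.univ \ u) \ M) \ x ∈ flip M G := by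
  rw [cellsA_parts_iff hT hM hutc hx, idW_union_inter_inter, idW_compl_union_inter_sdiff]

/-- C*-signability of the member `x ∪ M` (`x` disjoint from `M`): `M \ u ∈ Φ` and
`(u \ M) \ x ∈ Φ`. -/
theorem cellsC_union_iff (hT : Tight G) (hM : M = Rstar G) {u : Finset α}
    (hutc : TwinClosed G u) {x : Finset α} (hx : x ∪ M ∈ G) :
    Cells (G \\ G) (x ∪ M) (Finset.univ \ u) ↔
      M \ u ∈ flip M G ∧ (u \ M) \ x ∈ flip M G := by
  rw [cellsC_parts_iff hT hM hutc hx, idW_union_sdiff_inter, idW_sdiff_union_sdiff]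

/-- A-signability of the member `M \ y` (`y ⊆ M`): `(M ∩ u) \ y ∈ Φ` and `uᶜ \ M ∈ Φ`. -/
theorem cellsA_sdiff_iff (hT : Tight G) (hM : M = Rstar G) {u : Finset α}
    (hutc : TwinClosed G u) {y : Finset α} (hy : M \ y ∈ G) :
    Cells (G \\ G) (M \ y) u ↔
      (M ∩ u) \ y ∈ flip M G ∧ (Finset.univ \ u) \ M ∈ flip M G := by
  rw [cellsA_parts_iff hT hM hutc hy, idW_sdiff_inter_inter, idW_compl_sdiff_inter_sdiff]

/-- C*-signability of the member `M \ y` (`y ⊆ M`): `(M \ y) \ u ∈ Φ` and `u \ M ∈ Φ`. -/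
theorem cellsC_sdiff_iff (hT : Tight G) (hM : M = Rstar G) {u : Finset α}
    (hutc : TwinClosed G u) {y : Finset α} (hy : M \ y ∈ G) :
    Cells (G \\ G) (M \ y) (Finset.univ \ u) ↔
      (M \ y) \ u ∈ flip M G ∧ u \ M ∈ flip M G := by
  rw [cellsC_parts_iff hT hM hutc hy, idW_sdiff_sdiff_inter, idW_sdiff_sdiff_sdiff]

/-- `u` is a member once `u \ M` and `M \ u` are flipped members. -/
theorem mem_of_flags (hT : Tight G) (hM : M = Rstar G) {u : Finset α} (hutc : TwinClosed G u)
    (h1 : u \ M ∈ flip M G) (h2 : M \ u ∈ flip M G) : u ∈ G :=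
  mem_of_parts hT hM hutc h1 h2

/-- `uᶜ` is a member once `uᶜ \ M` and `u ∩ M` are flipped members. -/
theorem compl_mem_of_flags (hT : Tight G) (hM : M = Rstar G) {u : Finset α}
    (hutc : TwinClosed G u) (h1 : (Finset.univ \ u) \ M ∈ flip M G)
    (h2 : u ∩ M ∈ flip M G) : Finset.univ \ u ∈ G := by
  refine mem_of_parts hT hM ((twinClosed_univ G).sdiff hutc) h1 ?_
  rw [idW_sdiff_univ_sdiff]
  exact h2

end PercRepro.MSTight
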